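import Literature.Dynamics.Hyperbolic.ChowLinPalmerShadowingProofs

/-!
# Line `homoclinic-excursion-trains` (crux `BaireTransfer.DenseLoudDesignerForces`, stmt-AnomalousDissipation-1143):
# engine block E0 — the Chow–Lin–Palmer shadowing lemma, DISCHARGED

The engine of the line (`stub_oneLoopTrains`, lead -1's reshape v4 of 2026-08-16) is glued by the registered `engine_glue` from four
registered stubs, the first of which, `stub_chowLinPalmerShadowing : ChowLinPalmerShadowing.{0}`, is the Literature NAMED FACT
`Literature.Dynamics.Hyperbolic.ChowLinPalmerShadowing` (Pilyugin 1999 §1.3.4 (1.89)–(1.90); Chow–Lin–Palmer 1989) read at universe `0`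
(the universe of the section model `Sec = ℓ²(ℕ; ℝ)`).  That fact has since been PROVED in the tree
(`Literature/Dynamics/Hyperbolic/ChowLinPalmerShadowingProofs.lean`, `ChowLinPalmerShadowing_holds`, 2026-08-16), so the registered stub is
now a one-line specialisation; this file lands it under its registered name (courtesy landing by the lead of the sibling line
`ergodic-budget-selection-closing`, lead c4-0; no statement of the homoclinic line is changed).

Reference: S. Yu. Pilyugin, *Shadowing in Dynamical Systems*, LNM 1706 (1999), §1.3.4.
-/

set_option linter.dupNamespace false

namespace Summit.AnomalousDissipation.AnomalousDissipation.Theorems.DenseLoudDesignerForces.Homoclinic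

open Literature.Dynamics.Hyperbolic

/-- **Registered stub E0 of the homoclinic engine** (`stub_chowLinPalmerShadowing`, crux stmt-AnomalousDissipation-1143): the
Chow–Lin–Palmer shadowing lemma at universe `0`, by the tree's discharge `ChowLinPalmerShadowing_holds`.
[cite: Pilyugin1999, §1.3.4 (1.86)–(1.90)] -/
theorem stub_chowLinPalmerShadowing : ChowLinPalmerShadowing.{0} :=
  ChowLinPalmerShadowing_holds

end Summit.AnomalousDissipation.AnomalousDissipation.Theorems.DenseLoudDesignerForces.Homoclinic
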